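import Mathlib
import Literature.MathematicalPhysics.StatisticalMechanics.OneCrossingMixture

/-!
# Route `ReggeStarCoercivity`, crux stmt-AtomisticToContinuum-13601 `StabilityConstantTwelve`
# — line `Sketch`, stub `stub_cert_analytic` (analytic facts of the certificate family)

For a scale `σ > 0`, a cut-off `K : ℕ` and coefficients `b : ℕ → ℝ`, the certificate density is
the polynomial-times-exponential

  `a(t) = e^{-σt} Σ_{q<K} b_q σ^{q+2} t^{q+1} / (q+1)!`.

Everything below is a finite sum of Euler / Gamma integrals:

* `a` is integrable on `(0, ∞)` (termwise `integrableOn_exp_neg_mul_mul_pow`, tree file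
  `OneCrossingMixture.lean`);
* `a(t) t^{-3/2}` is integrable on `(0, ∞)`: on `t > 0`, `t^{q+1} t^{-3/2} = t^{(q+1/2)-1}` and the
  exponent `q - 1/2 > -1` (Mathlib `integrableOn_rpow_mul_exp_neg_mul_rpow`);
* the `t^{-3/2}`-mass in closed form,
  `∫_0^∞ a(t) t^{-3/2} dt = σ^{3/2} √π Σ_q b_q (2q-1)‼ / (2^q (q+1)!)`, from
  `∫_0^∞ t^{(q+1/2)-1} e^{-σt} dt = Γ(q+1/2) σ^{-(q+1/2)}` (Mathlib
  `Real.integral_rpow_mul_exp_neg_mul_Ioi`) and `Γ(q+1/2) = (2q-1)‼ √π / 2^q`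
  (`Real.Gamma_nat_add_half`), with `σ^{q+2} σ^{-(q+1/2)} = σ^{3/2}`;
* the Gaussian-mixture closed form, for `u ≥ 0`,
  `∫_0^∞ e^{-tu} a(t) dt = Σ_q b_q (σ/(σ+u))^{q+2}` (Euler's integral
  `∫_0^∞ e^{-t(σ+u)} t^{q+1} dt = (q+1)!/(σ+u)^{q+2}`, tree lemma `integral_exp_neg_mul_mul_pow`).

All `[folklore]`; no named facts are used.
-/

noncomputable section

namespace Summit.AtomisticToContinuum.Crystallization.Theorems

open MeasureTheory Set Real
open scoped Nat
open Literature.MathematicalPhysics.StatisticalMechanics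

/-- Exponent bookkeeping on `t > 0`: `t^{q+1} · t^{-3/2} = t^{(q + 1/2) - 1}` (natural power times
real power, `Real.rpow_natCast`, `Real.rpow_add`). [folklore] -/
theorem stub_cert_analytic_pow_mul_rpow (q : ℕ) {t : ℝ} (ht : 0 < t) :
    t ^ (q + 1) * t ^ (-(3 / 2 : ℝ)) = t ^ ((q : ℝ) + 1 / 2 - 1) := by
  rw [← Real.rpow_natCast, ← Real.rpow_add ht]
  congr 1
  push_cast
  ring

/-- Scale bookkeeping for `σ > 0`: `σ^{q+2} · (1/σ)^{q+1/2} = σ^{3/2}`. [folklore] -/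
theorem stub_cert_analytic_sigma_pow (q : ℕ) {σ : ℝ} (hσ : 0 < σ) :
    σ ^ (q + 2) * (1 / σ) ^ ((q : ℝ) + 1 / 2) = σ ^ ((3 : ℝ) / 2) := by
  rw [one_div, Real.inv_rpow hσ.le, ← Real.rpow_neg hσ.le, ← Real.rpow_natCast,
    ← Real.rpow_add hσ]
  congr 1
  push_cast
  ring

/-- Per-term constant bookkeeping for the `t^{-3/2}`-mass:
`(x σ^{q+2}/(q+1)!) · ((1/σ)^{q+1/2} · (D S / 2^q)) = σ^{3/2} S · (x D / (2^q (q+1)!))`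
(used with `D = (2q-1)‼`, `S = √π`). [folklore] -/
theorem stub_cert_analytic_mass_term (q : ℕ) {σ : ℝ} (hσ : 0 < σ) (x D S : ℝ) :
    x * σ ^ (q + 2) / ((q + 1)! : ℝ) * ((1 / σ) ^ ((q : ℝ) + 1 / 2) * (D * S / 2 ^ q)) =
      σ ^ ((3 : ℝ) / 2) * S * (x * D / (2 ^ q * (q + 1)! : ℝ)) := by
  rw [← stub_cert_analytic_sigma_pow q hσ]
  have hF : ((q + 1)! : ℝ) ≠ 0 := by positivity
  have h2 : (2 : ℝ) ^ q ≠ 0 := by positivity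
  field_simp

/-- Per-term constant bookkeeping for the Gaussian mixture:
`(x σ^{q+2}/(q+1)!) · ((q+1)!/β^{q+2}) = x (σ/β)^{q+2}` for `β ≠ 0`. [folklore] -/
theorem stub_cert_analytic_mixture_term (q : ℕ) {σ β : ℝ} (hβ : β ≠ 0) (x : ℝ) :
    x * σ ^ (q + 2) / ((q + 1)! : ℝ) * (((q + 1)! : ℝ) / β ^ (q + 1 + 1)) =
      x * (σ / β) ^ (q + 2) := by
  have hF : ((q + 1)! : ℝ) ≠ 0 := by positivity
  rw [div_pow]
  field_simp

/-- The Gamma integrand `t ↦ t^{(q+1/2)-1} e^{-σt}` is integrable on `(0, ∞)` for `σ > 0`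
(exponent `q - 1/2 > -1`; Mathlib `integrableOn_rpow_mul_exp_neg_mul_rpow` with `p = 1`).
[folklore] -/
theorem stub_cert_analytic_integrableOn_rpow (q : ℕ) {σ : ℝ} (hσ : 0 < σ) :
    IntegrableOn (fun t : ℝ => t ^ ((q : ℝ) + 1 / 2 - 1) * Real.exp (-(σ * t))) (Ioi 0) := by
  have hs : (-1 : ℝ) < (q : ℝ) + 1 / 2 - 1 := by
    have := q.cast_nonneg (α := ℝ)
    linarith
  have h := integrableOn_rpow_mul_exp_neg_mul_rpow (s := (q : ℝ) + 1 / 2 - 1) (p := 1) hs le_rfl hσ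
  refine h.congr_fun (fun t _ => ?_) measurableSet_Ioi
  dsimp only
  rw [Real.rpow_one, neg_mul]

/-- STUB S4a (analytic facts of the certificate family). For `σ > 0` and coefficients `b_q`,
the density `a(t) = e^{-σt} Σ_{q<K} b_q σ^{q+2} t^{q+1}/(q+1)!` is integrable on `(0,∞)`, so is
`a(t) t^{-3/2}`, its `t^{-3/2}`-mass is `σ^{3/2} √π Σ_q b_q (2q-1)‼ / (2^q (q+1)!)`
(`∫_0^∞ t^{q-1/2} e^{-σt} dt = Γ(q+1/2) σ^{-(q+1/2)}`, `Real.Gamma_nat_add_half`), and its Gaussian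
mixture is `∫_0^∞ e^{-tu} a(t) dt = Σ_q b_q (σ/(σ+u))^{q+2}` for `u ≥ 0` (Euler's integral,
`integral_exp_neg_mul_mul_pow`). [folklore] -/
theorem stub_cert_analytic (σ : ℝ) (hσ : 0 < σ) (K : ℕ) (b : ℕ → ℝ) (a : ℝ → ℝ)
    (ha : a = fun t => Real.exp (-(σ * t)) *
      ∑ q ∈ Finset.range K, b q * σ ^ (q + 2) * t ^ (q + 1) / ((q + 1)! : ℝ)) :
    IntegrableOn a (Ioi 0) ∧
    IntegrableOn (fun t => a t * t ^ (-(3 / 2 : ℝ))) (Ioi 0) ∧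
    (∫ t in Ioi 0, a t * t ^ (-(3 / 2 : ℝ))) =
      σ ^ ((3 : ℝ) / 2) * √π * ∑ q ∈ Finset.range K, b q * ((2 * q - 1)‼ : ℝ) / (2 ^ q * (q + 1)! : ℝ) ∧
    ∀ u : ℝ, 0 ≤ u →
      (∫ t in Ioi 0, Real.exp (-(t * u)) * a t) = ∑ q ∈ Finset.range K, b q * (σ / (σ + u)) ^ (q + 2) := by
  -- the coefficients `c_q = b_q σ^{q+2} / (q+1)!`
  obtain ⟨c, hc⟩ : ∃ c : ℕ → ℝ, ∀ q, c q = b q * σ ^ (q + 2) / ((q + 1)! : ℝ) :=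
    ⟨_, fun q => rfl⟩
  -- (A) `a` as a finite combination of the Euler integrands `e^{-tσ} t^{q+1}`
  have hA : ∀ t, a t = ∑ q ∈ Finset.range K, c q * (Real.exp (-(t * σ)) * t ^ (q + 1)) := by
    intro t
    rw [mul_comm t σ]
    simp only [ha, Finset.mul_sum]
    refine Finset.sum_congr rfl fun q _ => ?_
    rw [hc q]
    ring
  -- (B) `a(t) t^{-3/2}` as a finite combination of the Gamma integrands `t^{(q+1/2)-1} e^{-σt}`
  have hB : ∀ t ∈ Ioi (0 : ℝ), a t * t ^ (-(3 / 2 : ℝ)) =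
      ∑ q ∈ Finset.range K, c q * (t ^ ((q : ℝ) + 1 / 2 - 1) * Real.exp (-(σ * t))) := by
    intro t ht
    rw [hA, Finset.sum_mul]
    refine Finset.sum_congr rfl fun q _ => ?_
    rw [← stub_cert_analytic_pow_mul_rpow q ht, mul_comm t σ]
    ring
  -- (1) integrability of `a`
  have h1 : IntegrableOn a (Ioi 0) := by
    have e : a = fun t => ∑ q ∈ Finset.range K, c q * (Real.exp (-(t * σ)) * t ^ (q + 1)) :=
      funext hA
    rw [e]
    exact integrable_finsetSum _ fun q _ =>
      Integrable.const_mul (integrableOn_exp_neg_mul_mul_pow (q + 1) hσ) (c q)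
  -- termwise integrability of the mass integrand
  have hBi : ∀ q : ℕ, Integrable (fun t : ℝ => c q * (t ^ ((q : ℝ) + 1 / 2 - 1) * Real.exp (-(σ * t))))
      (volume.restrict (Ioi 0)) := fun q =>
    Integrable.const_mul (stub_cert_analytic_integrableOn_rpow q hσ) (c q)
  -- (2) integrability of `a(t) t^{-3/2}`
  have h2 : IntegrableOn (fun t => a t * t ^ (-(3 / 2 : ℝ))) (Ioi 0) := by
    have hsum : IntegrableOn (fun t : ℝ => ∑ q ∈ Finset.range K,
        c q * (t ^ ((q : ℝ) + 1 / 2 - 1) * Real.exp (-(σ * t)))) (Ioi 0) :=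
      integrable_finsetSum _ fun q _ => hBi q
    exact hsum.congr_fun (fun t ht => (hB t ht).symm) measurableSet_Ioi
  -- (3) the mass in closed form
  have h3 : (∫ t in Ioi 0, a t * t ^ (-(3 / 2 : ℝ))) =
      σ ^ ((3 : ℝ) / 2) * √π *
        ∑ q ∈ Finset.range K, b q * ((2 * q - 1)‼ : ℝ) / (2 ^ q * (q + 1)! : ℝ) := by
    rw [setIntegral_congr_fun measurableSet_Ioi hB, integral_finsetSum _ fun q _ => hBi q,
      Finset.mul_sum]
    refine Finset.sum_congr rfl fun q _ => ?_
    rw [integral_const_mul, Real.integral_rpow_mul_exp_neg_mul_Ioi (by positivity) hσ,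
      Real.Gamma_nat_add_half q, hc q]
    exact stub_cert_analytic_mass_term q hσ (b q) _ _
  -- (4) the Gaussian mixture in closed form
  have h4 : ∀ u : ℝ, 0 ≤ u → (∫ t in Ioi 0, Real.exp (-(t * u)) * a t) =
      ∑ q ∈ Finset.range K, b q * (σ / (σ + u)) ^ (q + 2) := by
    intro u hu
    have hβ : 0 < σ + u := by linarith
    have hC : ∀ t, Real.exp (-(t * u)) * a t =
        ∑ q ∈ Finset.range K, c q * (Real.exp (-(t * (σ + u))) * t ^ (q + 1)) := by
      intro t
      rw [hA, Finset.mul_sum]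
      refine Finset.sum_congr rfl fun q _ => ?_
      have he : Real.exp (-(t * (σ + u))) = Real.exp (-(t * σ)) * Real.exp (-(t * u)) := by
        rw [← Real.exp_add]
        congr 1
        ring
      rw [he]
      ring
    simp_rw [hC]
    rw [integral_finsetSum _ fun q _ =>
      Integrable.const_mul (integrableOn_exp_neg_mul_mul_pow (q + 1) hβ) (c q)]
    refine Finset.sum_congr rfl fun q _ => ?_
    rw [integral_const_mul, integral_exp_neg_mul_mul_pow (q + 1) hβ, hc q]
    exact stub_cert_analytic_mixture_term q hβ.ne' (b q)
  exact ⟨h1, h2, h3, h4⟩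

end Summit.AtomisticToContinuum.Crystallization.Theorems
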